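import Summits.HodgeConjecture.HodgeConjecture.Theorems.R90S6ConstantTermTransport          -- ★ B2a FILE 1 (this seat): (T.1) `integral_prod_coeff_toVector_conj_eq_mul`, (T.2), §4 `integral_prod_coeff_toVector_frame_eq`
import Literature.NumberTheory.Automorphic.UnitaryGroupTorusOrbitalIntegralCanonical        -- ★ `classOrbitalIntegral_eq_smul_integral_prod_of_torus_regular` (S0 «CONVENTIONS JOINT» FILE 2, F0P3b-p01)
import HarnessLib

/-!
# R90 · S6 «Ch. 14.1–14.5 stable trace formula» — CARD B2a, FILE 2 (row E1.3.6.2): THE VALUE OF THE CANONICAL ORBITAL INTEGRAL OF A HECKE OPERATOR AT A REGULAR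
# SPLIT-TORUS CLASS THROUGH A BOREL-COMPATIBLE FRAME — `Φ_G(⟦e t⟧, T[K₀]∘eG) = (νG(e K₃)·J₃(t)) · w(a(E t))⁻¹ · 𝒮(T)_{a(E t)}` (`Theorems/R90S6ConstantTermTransportValue.lean`)

Dealer R90-C14-plan (g2), RULING F5-R1 2026-09-05T01:10:47Z + CARD B2a 01:13:19Z + letter 01:15:59Z (p09 (g0)'s hand-over census l.7487).  SETTING = the binder block of ★
`classOrbitalIntegral_eq_smul_integral_prod_of_torus_regular` VERBATIM (`L` CM, `H` hermitian with `IsUnit H.det`, non-split `w ∣ v`, the stub's Jacobowitz frame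
`e := cmDatumLocalCongr L v T ha h : U(Φ₃)(L⁺_v) ≃ₜ* U(H)(L⁺_v)`, ANY Haar `νG`, CANONICAL `mG`, the hyperspecial `K ≤ U(Φ₃)(L⁺_v)` by membership `hKv`, Haar `κ`, `μ_N`, a REGULAR
diagonal `t ∈ T(L⁺_v)` with the twist data) + THE HECKE DATA: `σ_w = galAdicCompletionMap c hw`, `U′ = U(σ_w, J₀)(L_w) = unitaryGroupOfForm σ_w ((StdForm.antidiagonal 3).over L_w)`
(the socket's carrier, D :246–:321 of `R90_S6_FloorE1D`), `K₀ = unitaryInt`, `N′ = unipotentU`, `hd : UnramifiedLocalConjDatum σ_w ϖ`, `T ∈ ℋ(U′, K₀)`, and a frame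
`eG : U(H)(L⁺_v) ≃ₜ* U′` such that the COMPOSITE `E := e ≫ eG : U(Φ₃)(L⁺_v) ≃ₜ* U′` satisfies the N-LAW (`g ∈ N ↔ E g ∈ N′`) and the K-LAW (`E g ∈ K₀ ↔ g ∈ K`) — binders, so that
the eG-independence row E1.3.9.1 is not re-entered (★ `stubR90ExtE1HeckeFL_of_oneFrames` moves the result to every socket frame); `EN : ↥N ≃ₜ* ↥N′` any restriction of `E`.

* §1 `continuous_coeff_mk` — `g ↦ v.coeff (gK₀)` is continuous (locally constant) for `K₀` open; hence the test function `T[K₀] ∘ eG` is Borel (`measurable_coeff_toVector_comp`).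
* §2 **`classOrbitalIntegral_coeff_toVector_frame_eq`** (THE VALUE): with `S := {n : ↥N | ↑n ∈ K}`,
  `classOrbitalIntegral mG (T[K₀] ∘ eG) ⟦e t⟧ = (νG(e.symm⁻¹ K) · J₃(t)).toReal • (w(a(E t))⁻¹ · 𝒮(T)_{a(E t)})` — ★ torus-regular canonical value (the `K × N` integral
  with the constant `νG(e.symm⁻¹ K)∕(κ(K)·μ_N(S)) · J₃(t)`) ∘ ★ FILE 1 §4 (`∫_{K×N} = κ(K) · μ_N(S) · w⁻¹ · 𝒮_a`): the auxiliary volumes `κ(K)`, `μ_N(S)` CANCEL (binders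
  `hκ : κ univ ≠ ∞`, `hμ : μ_N S ≠ ∞`, `hKo : IsOpen K` for the non-vanishing); `J₃(t)` is the ★ token VERBATIM.

The specialisations (`a(E t) = ℓ_m`, `w₃(ℓ_m)⁻¹ = Q^m` ★ `satakeWeight_lineThree_residueCardSqrt`, `E := eA` the one-place model with ★ `localNonsplitEquiv` letters, the H-twin
at `N = 2`) are the closing file `Theorems/R90S6ConstantTermTransportAtPlace.lean` and (B2d).
Cell `hodgecm-mathlib`, crux H413 (`stmt-HodgeConjecture-24833`), route of record `HCCMUnconditional`; programme R90-TF (brief `director/R90-BRIEF.v2.md` 1f40d54518340a35),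
section S6 (base `R90-C14`), seat R90-C14-p01 (g2).  Lane `--kind proof --supports stmt-HodgeConjecture-24833 --as helper`; THEOREMS ONLY (no definition, no instance, no notation,
no named fact, no kit, no `sorry`); imports ★ FILE 1 + ★ `UnitaryGroupTorusOrbitalIntegralCanonical` + HarnessLib; never `Lines/`.
HONEST LABEL: measure bookkeeping, count-neutral until (B2d) `R90S6HyperbolicHeckeFL` consumes it; proves no printed global statement, discharges no citation; HC_CM is proved only
modulo the 7 printed citations (2 remaining named inputs: hLiu418 = stmt-HodgeConjecture-24832, h413 = stmt-HodgeConjecture-24833) until rung 0 closes.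

## References
* [Rogawski1990] J. D. Rogawski, *Automorphic Representations of Unitary Groups in Three Variables*, Ann. of Math. Stud. 123 (1990): §4.9 (4.9.2) p. 55, Lemma 4.9.2 pp. 55–56
  («`Φ(γ, f) = |D(γ)|⁻¹ f^{(B)}(γ)`» for `f` in the Hecke algebra); §4.13 p. 70; §4.3 (4.3.1) p. 43.
* [CartierCorvallis1979] P. Cartier, *Representations of 𝔭-adic groups: a survey*, PSPM 33.1 (1979): §IV (4.2) p. 146.
* [DeitmarEchterhoff2014] A. Deitmar, S. Echterhoff, *Principles of Harmonic Analysis*, 2nd ed. (2014): Thm. 1.5.3.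
-/

set_option autoImplicit false
-- the mandated namespace repeats the single-problem summit's segment (`HodgeConjecture.HodgeConjecture`)
set_option linter.dupNamespace false

noncomputable section

open MeasureTheory Measure Set Function NumberField IsDedekindDomain
open scoped ENNReal NNReal Pointwise Valued WithZero Matrix MatrixGroups
open MulAction
open Literature.MeasureTheory.Group
open Literature.NumberTheory.Automorphic Literature.NumberTheory.Automorphic.HermitianLattice Literature.NumberTheory.Automorphic.heckeAlgebra
  Literature.NumberTheory.Automorphic.UnitaryGroup Literature.NumberTheory.Automorphic.HermitianLattice.UnramifiedLocalConjDatum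
open Literature.NumberTheory.Rogawski1990 (IsRegularElt)

namespace Summit.HodgeConjecture.HodgeConjecture.R90.S6

/-! ## §1 The Hecke test function `g ↦ T[K₀](gK₀)` is continuous (locally constant) for `K₀` open -/

section Continuity

variable {G : Type*} [Group G] [TopologicalSpace G] [IsTopologicalGroup G] (K₀ : Subgroup G)

/-- **A function of the coset is locally constant**: for `K₀` open and any `v : ℂ[G ⧸ K₀]`, `g ↦ v.coeff (gK₀)` is continuous on `G` (its fibres are unions of left cosets
`gK₀ = (g⁻¹·)⁻¹ K₀`, which are open). [cite: CartierCorvallis1979, §IV Thm. 4.1] -/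
theorem continuous_coeff_mk (hK : IsOpen (K₀ : Set G)) (v : MonoidAlgebra ℂ (G ⧸ K₀)) : Continuous fun g : G => v.coeff (g : G ⧸ K₀) := by
  refine continuous_def.2 fun s _ => isOpen_iff_forall_mem_open.2 fun x hx => ?_
  refine ⟨(fun y : G => x⁻¹ * y) ⁻¹' (K₀ : Set G), fun y hy => ?_, hK.preimage (continuous_const.mul continuous_id), ?_⟩
  · -- on the coset `xK₀` the value is that at `x`
    have hxy : ((y : G) : G ⧸ K₀) = (x : G ⧸ K₀) := (QuotientGroup.eq.2 hy).symm
    rw [Set.mem_preimage] at hx ⊢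
    rw [hxy]
    exact hx
  · rw [Set.mem_preimage, inv_mul_cancel]
    exact K₀.one_mem

/-- **The transported Hecke test function is Borel**: for `K₀` open, `T ∈ ℋ(G, K₀)` and any continuous `eG : G₁ → G` into `G` from a Borel group, `g ↦ T[K₀](eG g)` is measurable.
[cite: CartierCorvallis1979, §IV Thm. 4.1] -/
theorem measurable_coeff_toVector_comp {G₁ : Type*} [TopologicalSpace G₁] [MeasurableSpace G₁] [OpensMeasurableSpace G₁] (hK : IsOpen (K₀ : Set G))
    (T : heckeAlgebra ℂ G K₀) {eG : G₁ → G} (heG : Continuous eG) :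
    Measurable fun g : G₁ => (toVector K₀ T).coeff ((eG g : G) : G ⧸ K₀) :=
  ((continuous_coeff_mk K₀ hK (toVector K₀ T)).comp heG).measurable

end Continuity

/-! ## §2 THE VALUE at a regular split-torus class through a Borel-compatible frame -/

/-- Arithmetic of the cancellation: `(A ∕ (b c) · J).toReal · (b.toReal · (c.toReal · X)) = (A · J).toReal · X` for `b, c ∈ (0, ∞)`. [cite: Rogawski1990, §4.3 (4.3.1) p. 43] -/
theorem toReal_div_mul_mul_smul_eq {A b c J : ℝ≥0∞} (hb0 : b ≠ 0) (hb : b ≠ ∞) (hc0 : c ≠ 0) (hc : c ≠ ∞) (X : ℂ) :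
    (A / (b * c) * J).toReal • ((b.toReal : ℂ) * ((c.toReal : ℂ) * X)) = (A * J).toReal • X := by
  have hbc0 : b * c ≠ 0 := mul_ne_zero hb0 hc0
  have hbcT : b * c ≠ ∞ := ENNReal.mul_ne_top hb hc
  have hkey : A / (b * c) * J * (b * c) = A * J := by
    rw [mul_right_comm, ENNReal.div_mul_cancel hbc0 hbcT]
  have hreal : (A / (b * c) * J).toReal * (b.toReal * c.toReal) = (A * J).toReal := by
    rw [← ENNReal.toReal_mul, ← ENNReal.toReal_mul, hkey]
  rw [Complex.real_smul, Complex.real_smul, ← hreal]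
  push_cast
  ring

set_option maxHeartbeats 1600000 in
-- instance-term unification on the two spellings of the CM local carrier `U(Φ₃)(L⁺_v)` — the SAME budget and reason as ★
-- `classOrbitalIntegral_eq_smul_integral_prod_of_torus_regular` itself (`UnitaryGroupTorusOrbitalIntegralCanonical`) and ★ `F0P3CMBorelIwahoriDatum`
/-- **CARD B2a — THE CANONICAL ORBITAL INTEGRAL OF A HECKE OPERATOR AT A REGULAR SPLIT-TORUS CLASS, THROUGH A BOREL-COMPATIBLE FRAME.**  In the setting of ★
`classOrbitalIntegral_eq_smul_integral_prod_of_torus_regular` (binders VERBATIM: `H`, the stub's frame `e = cmDatumLocalCongr L v T ha h`, Haar `νG`, canonical `mG`, the hyperspecial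
`K` by `hKv`, Haar s-finite `κ`, `μ_N`, a regular diagonal `t ∈ T(L⁺_v)` with twist data `ha' hb'`), let `eG : U(H)(L⁺_v) ≃ₜ* U′ = U(σ_w, J₀)(L_w)` be a frame whose composite with `e`
satisfies the N-LAW `hN` and the K-LAW `hEK`, `EN` any restriction of `e ≫ eG` to `N ≃ N′`, `hd` the unramified datum at `w`, `T ∈ ℋ(U′, K₀)`.  Then, with `S = {n : ↥N | ↑n ∈ K}`
(`κ(K), μ_N(S)` finite: `hκ`, `hμ`; `K` open: `hKo`):
`classOrbitalIntegral mG (g ↦ T[K₀](eG g)) ⟦e t⟧ = (νG(e.symm⁻¹ K) · J₃(t)).toReal • ((q^{−⟨ν,a(eG(e t))⟩∕2})⁻¹ · 𝒮(T)_{a(eG(e t))})`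
— Rogawski's «`Φ(γ, f) = |D(γ)|⁻¹ f^{(B)}(γ)`» (4.9.2) for `f ∈ ℋ` with Cartier's `f^{(B)} = δ^{1∕2}·𝒮f`, in the tree's canonical normalisation; the auxiliary volumes cancel.
[cite: Rogawski1990, §4.9 (4.9.2) p. 55; §4.13 p. 70; §4.3 (4.3.1) p. 43] [cite: CartierCorvallis1979, §IV (4.2) p. 146] [cite: DeitmarEchterhoff2014, Thm. 1.5.3] -/
theorem classOrbitalIntegral_coeff_toVector_frame_eq
    (L : Type) [Field L] [NumberField L] [IsCMField L] (H : Matrix (Fin 3) (Fin 3) L)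
    (hH : (H.map (IsCMField.complexConj L))ᵀ = H) (hHd : IsUnit H.det)
    {v : HeightOneSpectrum (𝓞 ↥(maximalRealSubfield L))} (w : PlacesOver L v) (hw : IsCMField.complexConj L • w.1 = w.1)
    (T₀ : GL (Fin 3) (LocalRing L v)) {a : LocalRing L v} (ha : IsUnit a)
    (h : formCongr (conjLocal L (IsCMField.complexConj L) v) T₀ (H.map (algebraMap L (LocalRing L v))) =
      a • (Matrix.of fun i j : Fin 3 => if i.val + j.val + 1 = 3 then (1 : L) else 0).map (algebraMap L (LocalRing L v)))
    [MeasurableSpace ((cmDatum L 3 H).Local v)] [BorelSpace ((cmDatum L 3 H).Local v)]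
    [∀ γ : (cmDatum L 3 H).Local v, MeasurableSpace (((cmDatum L 3 H).Local v) ⧸ Subgroup.centralizer ({γ} : Set ((cmDatum L 3 H).Local v)))]
    [∀ γ : (cmDatum L 3 H).Local v, BorelSpace (((cmDatum L 3 H).Local v) ⧸ Subgroup.centralizer ({γ} : Set ((cmDatum L 3 H).Local v)))]
    (νG : Measure ((cmDatum L 3 H).Local v)) [νG.IsHaarMeasure] [νG.IsMulRightInvariant]
    {mG : OrbitalMeasureFamily ((cmDatum L 3 H).Local v)}
    (hmG : mG.IsCanonical (fun γ => IsRegularElt (γ.val : GL (Fin 3) (LocalRing L v))) νG)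
    [MeasurableSpace ↥(unitaryGroupOfForm (conjLocal L (IsCMField.complexConj L) v) (cmLocalForm L 3 v))]
    [BorelSpace ↥(unitaryGroupOfForm (conjLocal L (IsCMField.complexConj L) v) (cmLocalForm L 3 v))]
    {K : Subgroup ↥(unitaryGroupOfForm (conjLocal L (IsCMField.complexConj L) v) (cmLocalForm L 3 v))}
    (hKv : ∀ g : ↥(unitaryGroupOfForm (conjLocal L (IsCMField.complexConj L) v) (cmLocalForm L 3 v)),
      g ∈ K ↔ g ∈ cmLocalIntegralLevel L 3 (Matrix.of fun i j : Fin 3 => if i.val + j.val + 1 = 3 then (1 : L) else 0) v)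
    (hKo : IsOpen (K : Set ↥(unitaryGroupOfForm (conjLocal L (IsCMField.complexConj L) v) (cmLocalForm L 3 v))))
    (κ : Measure ↥K) [κ.IsHaarMeasure] [SFinite κ] (hκ : κ Set.univ ≠ ∞)
    (μN : Measure ↥(unipotentU (conjLocal L (IsCMField.complexConj L) v) (cmLocalForm L 3 v))) [μN.IsHaarMeasure] [SFinite μN]
    (hμ : μN {n | (n : ↥(unitaryGroupOfForm (conjLocal L (IsCMField.complexConj L) v) (cmLocalForm L 3 v))) ∈ K} ≠ ∞)
    (t : ↥(torusU (conjLocal L (IsCMField.complexConj L) v) (cmLocalForm L 3 v))) {d : Fin 3 → (LocalRing L v)ˣ}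
    (hd : glDiagonal 3 (LocalRing L v) d =
      ((t : ↥(unitaryGroupOfForm (conjLocal L (IsCMField.complexConj L) v) (cmLocalForm L 3 v))) : GL (Fin 3) (LocalRing L v)))
    (hreg : ∀ i j, i ≠ j → IsUnit ((d i : LocalRing L v) - d j))
    (ha' : IsUnit ((((d 0)⁻¹ * d 1 : (LocalRing L v)ˣ) : LocalRing L v) - 1))
    (hb' : IsUnit ((((d 0)⁻¹ * d 2 : (LocalRing L v)ˣ) : LocalRing L v) - 1))
    -- the Hecke side: the socket's carrier at `w`, the unramified datum, the frame `eG`, the laws of the composite `e ≫ eG`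
    [MeasurableSpace ↥(unitaryGroupOfForm (galAdicCompletionMap (L := L) (IsCMField.complexConj L) hw) ((StdForm.antidiagonal 3).over (w.1.adicCompletion L)))]
    [BorelSpace ↥(unitaryGroupOfForm (galAdicCompletionMap (L := L) (IsCMField.complexConj L) hw) ((StdForm.antidiagonal 3).over (w.1.adicCompletion L)))]
    [Finite 𝓀[w.1.adicCompletion L]] {ϖ : w.1.adicCompletion L}
    (hdw : UnramifiedLocalConjDatum (galAdicCompletionMap (L := L) (IsCMField.complexConj L) hw) ϖ)
    (eG : (cmDatum L 3 H).Local v ≃ₜ*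
      ↥(unitaryGroupOfForm (galAdicCompletionMap (L := L) (IsCMField.complexConj L) hw) ((StdForm.antidiagonal 3).over (w.1.adicCompletion L))))
    (hN : ∀ g : ↥(unitaryGroupOfForm (conjLocal L (IsCMField.complexConj L) v) (cmLocalForm L 3 v)),
      g ∈ unipotentU (conjLocal L (IsCMField.complexConj L) v) (cmLocalForm L 3 v) ↔
        eG (cmDatumLocalCongr L v T₀ ha h g) ∈
          unipotentU (galAdicCompletionMap (L := L) (IsCMField.complexConj L) hw) ((StdForm.antidiagonal 3).over (w.1.adicCompletion L)))
    (hEK : ∀ g : ↥(unitaryGroupOfForm (conjLocal L (IsCMField.complexConj L) v) (cmLocalForm L 3 v)),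
      eG (cmDatumLocalCongr L v T₀ ha h g) ∈
          unitaryInt (galAdicCompletionMap (L := L) (IsCMField.complexConj L) hw) ((StdForm.antidiagonal 3).over (w.1.adicCompletion L)) ↔ g ∈ K)
    (EN : ↥(unipotentU (conjLocal L (IsCMField.complexConj L) v) (cmLocalForm L 3 v)) ≃ₜ*
      ↥(unipotentU (galAdicCompletionMap (L := L) (IsCMField.complexConj L) hw) ((StdForm.antidiagonal 3).over (w.1.adicCompletion L))))
    (hEN : ∀ n : ↥(unipotentU (conjLocal L (IsCMField.complexConj L) v) (cmLocalForm L 3 v)),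
      ((EN n : ↥(unipotentU (galAdicCompletionMap (L := L) (IsCMField.complexConj L) hw) ((StdForm.antidiagonal 3).over (w.1.adicCompletion L)))) :
          ↥(unitaryGroupOfForm (galAdicCompletionMap (L := L) (IsCMField.complexConj L) hw) ((StdForm.antidiagonal 3).over (w.1.adicCompletion L)))) =
        eG (cmDatumLocalCongr L v T₀ ha h (n : ↥(unitaryGroupOfForm (conjLocal L (IsCMField.complexConj L) v) (cmLocalForm L 3 v)))))
    (T : heckeAlgebra ℂ ↥(unitaryGroupOfForm (galAdicCompletionMap (L := L) (IsCMField.complexConj L) hw) ((StdForm.antidiagonal 3).over (w.1.adicCompletion L)))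
      (unitaryInt (galAdicCompletionMap (L := L) (IsCMField.complexConj L) hw) ((StdForm.antidiagonal 3).over (w.1.adicCompletion L)))) :
    classOrbitalIntegral mG
        (fun g : (cmDatum L 3 H).Local v =>
          (toVector (unitaryInt (galAdicCompletionMap (L := L) (IsCMField.complexConj L) hw) ((StdForm.antidiagonal 3).over (w.1.adicCompletion L))) T).coeff
            ((eG g : ↥(unitaryGroupOfForm (galAdicCompletionMap (L := L) (IsCMField.complexConj L) hw) ((StdForm.antidiagonal 3).over (w.1.adicCompletion L)))) :
              ↥(unitaryGroupOfForm (galAdicCompletionMap (L := L) (IsCMField.complexConj L) hw) ((StdForm.antidiagonal 3).over (w.1.adicCompletion L))) ⧸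
                unitaryInt (galAdicCompletionMap (L := L) (IsCMField.complexConj L) hw) ((StdForm.antidiagonal 3).over (w.1.adicCompletion L))))
        (ConjClasses.mk (cmDatumLocalCongr L v T₀ ha h (t : ↥(unitaryGroupOfForm (conjLocal L (IsCMField.complexConj L) v) (cmLocalForm L 3 v))))) =
      ((νG ((cmDatumLocalCongr L v T₀ ha h).symm ⁻¹' (K : Set ↥(unitaryGroupOfForm (conjLocal L (IsCMField.complexConj L) v) (cmLocalForm L 3 v))))) *
          ((letI : MeasurableSpace (LocalRing L v) := borel _; haveI : BorelSpace (LocalRing L v) := ⟨rfl⟩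
          haveI : SecondCountableTopology (LocalRing L v) := secondCountableTopology_localRing (E := L) v
          ((distribHaarChar (LocalRing L v) ha'.unit)⁻¹ *
            (HeisRing.skewModulus (conjLocal L (IsCMField.complexConj L) v) (continuous_conjLocal L (IsCMField.complexConj L) v) hb'.unit
              (HeisRing.map_unit_torusCentralScalar_sub_one (conjLocal L (IsCMField.complexConj L) v) (cmLocalForm_eq_over L 3 v) t hd hb'))⁻¹ :
                ℝ≥0)) : ℝ≥0∞)).toReal •
        ((satakeWeight (residueCardSqrt (w.1.adicCompletion L))
            (hdw.iwasawaExp (eG (cmDatumLocalCongr L v T₀ ha h (t : ↥(unitaryGroupOfForm (conjLocal L (IsCMField.complexConj L) v) (cmLocalForm L 3 v)))))))⁻¹ *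
          (hdw.satakeTransform T).coeff
            (hdw.iwasawaExp (eG (cmDatumLocalCongr L v T₀ ha h (t : ↥(unitaryGroupOfForm (conjLocal L (IsCMField.complexConj L) v) (cmLocalForm L 3 v))))))) := by
  -- measurability of the Hecke test function through `eG` (stated in the letters of the conclusion)
  have hK₀ : IsOpen (unitaryInt (galAdicCompletionMap (L := L) (IsCMField.complexConj L) hw) ((StdForm.antidiagonal 3).over (w.1.adicCompletion L)) :
      Set ↥(unitaryGroupOfForm (galAdicCompletionMap (L := L) (IsCMField.complexConj L) hw) ((StdForm.antidiagonal 3).over (w.1.adicCompletion L)))) :=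
    isOpen_unitaryInt _ _
  have hφ : Measurable fun g : (cmDatum L 3 H).Local v =>
      (toVector (unitaryInt (galAdicCompletionMap (L := L) (IsCMField.complexConj L) hw) ((StdForm.antidiagonal 3).over (w.1.adicCompletion L))) T).coeff
        ((eG g : ↥(unitaryGroupOfForm (galAdicCompletionMap (L := L) (IsCMField.complexConj L) hw) ((StdForm.antidiagonal 3).over (w.1.adicCompletion L)))) :
          ↥(unitaryGroupOfForm (galAdicCompletionMap (L := L) (IsCMField.complexConj L) hw) ((StdForm.antidiagonal 3).over (w.1.adicCompletion L))) ⧸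
            unitaryInt (galAdicCompletionMap (L := L) (IsCMField.complexConj L) hw) ((StdForm.antidiagonal 3).over (w.1.adicCompletion L))) :=
    measurable_coeff_toVector_comp _ hK₀ T (eG := fun g => eG g) eG.continuous
  -- ★ the canonical value at `⟦e t⟧` as the `K × N` integral
  refine (classOrbitalIntegral_eq_smul_integral_prod_of_torus_regular L H hH hHd w hw T₀ ha h νG hmG hKv κ μN t hd hreg ha' hb' hφ).trans ?_
  -- ★ FILE 1 §4 through the composite frame `E := e ≫ eG`, re-typed on the `unitaryGroupOfForm` spelling of `U(Φ₃)(L⁺_v)` (★ `cmDatum_Local_eq`, `rfl`)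
  have ht : (t : ↥(unitaryGroupOfForm (conjLocal L (IsCMField.complexConj L) v) (cmLocalForm L 3 v))) ∈
      Subgroup.normalizer (unipotentU (conjLocal L (IsCMField.complexConj L) v) (cmLocalForm L 3 v) :
        Set ↥(unitaryGroupOfForm (conjLocal L (IsCMField.complexConj L) v) (cmLocalForm L 3 v))) :=
    borelU_le_normalizer _ _ (torusU_le_borelU _ _ t.2)
  obtain ⟨E, hE⟩ : ∃ E : ↥(unitaryGroupOfForm (conjLocal L (IsCMField.complexConj L) v) (cmLocalForm L 3 v)) ≃ₜ*
      ↥(unitaryGroupOfForm (galAdicCompletionMap (L := L) (IsCMField.complexConj L) hw) ((StdForm.antidiagonal 3).over (w.1.adicCompletion L))),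
      ∀ g, E g = eG (cmDatumLocalCongr L v T₀ ha h g) :=
    ⟨(cmDatumLocalCongr L v T₀ ha h).trans eG, fun g => rfl⟩
  have hN' : ∀ g : ↥(unitaryGroupOfForm (conjLocal L (IsCMField.complexConj L) v) (cmLocalForm L 3 v)),
      g ∈ unipotentU (conjLocal L (IsCMField.complexConj L) v) (cmLocalForm L 3 v) ↔
        E g ∈ unipotentU (galAdicCompletionMap (L := L) (IsCMField.complexConj L) hw) ((StdForm.antidiagonal 3).over (w.1.adicCompletion L)) :=
    fun g => (hN g).trans (by rw [hE])
  have hEK' : ∀ g : ↥(unitaryGroupOfForm (conjLocal L (IsCMField.complexConj L) v) (cmLocalForm L 3 v)),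
      E g ∈ unitaryInt (galAdicCompletionMap (L := L) (IsCMField.complexConj L) hw) ((StdForm.antidiagonal 3).over (w.1.adicCompletion L)) ↔ g ∈ K :=
    fun g => (show _ ↔ _ by rw [hE]).trans (hEK g)
  have hEN' : ∀ n : ↥(unipotentU (conjLocal L (IsCMField.complexConj L) v) (cmLocalForm L 3 v)),
      ((EN n : ↥(unipotentU (galAdicCompletionMap (L := L) (IsCMField.complexConj L) hw) ((StdForm.antidiagonal 3).over (w.1.adicCompletion L)))) :
          ↥(unitaryGroupOfForm (galAdicCompletionMap (L := L) (IsCMField.complexConj L) hw) ((StdForm.antidiagonal 3).over (w.1.adicCompletion L)))) = E n :=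
    fun n => (hEN n).trans (hE n).symm
  have hI := integral_prod_coeff_toVector_frame_eq E hN' hEK' EN hEN' μN κ hdw T ht hμ
  simp only [hE] at hI
  rw [hI]
  -- the auxiliary volumes cancel
  have hκ0 : κ Set.univ ≠ 0 := IsOpenPosMeasure.open_pos _ isOpen_univ Set.univ_nonempty
  have hμ0 : μN {n | (n : ↥(unitaryGroupOfForm (conjLocal L (IsCMField.complexConj L) v) (cmLocalForm L 3 v))) ∈ K} ≠ 0 :=
    IsOpenPosMeasure.open_pos _ (hKo.preimage continuous_subtype_val)
      ⟨1, (K.one_mem : ((1 : ↥(unipotentU (conjLocal L (IsCMField.complexConj L) v) (cmLocalForm L 3 v))) :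
        ↥(unitaryGroupOfForm (conjLocal L (IsCMField.complexConj L) v) (cmLocalForm L 3 v))) ∈ K)⟩
  exact toReal_div_mul_mul_smul_eq hκ0 hκ hμ0 hμ _

end Summit.HodgeConjecture.HodgeConjecture.R90.S6

end
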